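import Summits.BirchSwinnertonDyer.Rank1Residual.X2.GreenbergVatsalCaseTwo
import Summits.BirchSwinnertonDyer.Rank1Residual.X2.IsogenyPeriodRatio
import Summits.BirchSwinnertonDyer.Rank1Residual.X2.ClassClosureOfDerivedTrivialZero
import HarnessLib

/-!
# GV CASE 2 and the X2a closure terms WITHOUT the period fact A180 (cell `b2b-bsdres`, unit
# `b2b-bsdres-eisenstein-p2`, gen 28)

HONEST FRAMING (run/shared/lean/b2b/bsd-rank1-residual/, verbatim in every file): the goal of the
cell is to DELETE the COMBINATION-SHAPED residual classes of the Birch–Swinnerton-Dyer formula for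
ALL analytic-rank `≤ 1` elliptic curves over `ℚ` — "full BSD formula for every rank `≤ 1` curve in
class `C`" assembled STRICTLY from published theorems — so that the rank-`≤ 1` remainder becomes
exactly the CONSTRUCTION-SHAPED classes, which are TYPED (missing-input `Prop`s), NOT attempted.
This is not "finishing BSD". Research route; NO CLAIM BEYOND STATED CLASSES; nothing here changes
a label. Theorems only; no definition, no named fact.

WHAT. The registered fact A180 (`GreenbergVatsal2000.cor38_realPeriodRat_eq_unit_mul_of_isIsogenous_of_gvPar`,
GV Cor. (3.8): the real periods of the curve and of its quotient by the GV line differ by a `p`-adic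
unit) is consumed by the X2a chain at exactly one place of the multiplicative ladder — gen 18's
`GreenbergVatsalCaseTwo.caseTwo_clause_of_inputs` (binder `hP`).  Gen 28 PROVED that input in the
kernel for the quotient the chain actually builds (`X2/IsogenyPeriodRatio.exists_quot_realPeriodRat_eq_unit_mul`:
unramified odd line ⇒ `Ω(E/Φ₀) = u·Ω(E)`, `|u|_p = 1`; elementary `p`-adic analysis of the Vélu
quotient + the real uniformisation).  This file re-threads the ladder WITHOUT `hP`:

* `caseTwo_clause_of_inputs_periodFree` — gen 18's CASE 2 with the period supplied by the theorem;
* `lambda_muAnal_multiplicative_of_gvPar_of_inputs_periodFree` (A64 from CASE 1 + CASE 2),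
  `lambda_muAnal_multiplicative_of_gvPar_periodFree` / `lambdaMu_multiplicative_of_gvPar_periodFree`
  (A64 / A63 from the gen-27 fact list MINUS A180: T-GV23L, A137′, A40, A41, A135, A195, A226, A224,
  A225 [+ A33]);
* `mazurMainConjectureAt_of_gvPar_periodFree`, **`targetA_periodFree_heightFree`** — the X2a closure
  of record with SIXTEEN registered-fact binders (gen 27: seventeen; `hP` A180 is gone).

References: [GreenbergVatsal2000] Thm. (1.3), §2 p. 28, §3 Cor. (3.8), Thm. (3.11);
[DokchitserLocalInvariants2015] Props. 16, 18, Thm. 2; HOME/b2b-bsdres-eisenstein-p2/X2-GAP.md §33.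
-/

set_option autoImplicit false

noncomputable section

open scoped Classical AddSubgroup MatrixGroups ModularForm

open PowerSeries NumberField IsDedekindDomain Field WeierstrassCurve CongruenceSubgroup
  Literature.NumberTheory.EllipticCurves Literature.NumberTheory.EllipticCurves.GreenbergVatsal2000
  Literature.NumberTheory.EllipticCurves.ModularForms
  Literature.NumberTheory.EllipticCurves.Rank1Residual
  Literature.NumberTheory.EllipticCurves.Rank1Residual.Typed
  Literature.NumberTheory.EllipticCurves.Greenberg1999
  Literature.NumberTheory.EllipticCurves.Wuthrich2014
  Literature.NumberTheory.EllipticCurves.SteinWuthrich2013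
  Summit.BirchSwinnertonDyer.Rank1Residual.X2.IsogenyQuotientLine
  Summit.BirchSwinnertonDyer.Rank1Residual.X2.IsogenyLineType
  Summit.BirchSwinnertonDyer.Rank1Residual.X2.IsogenyLambdaInvariant
  Summit.BirchSwinnertonDyer.Rank1Residual.X2.GreenbergVatsalAnalyticTransferCore
  Summit.BirchSwinnertonDyer.Rank1Residual.X2.GreenbergVatsalCaseTwo
  Summit.BirchSwinnertonDyer.Rank1Residual.X2.GreenbergVatsalInputsOfFacts
  Summit.BirchSwinnertonDyer.Rank1Residual.X2.EisensteinCongruenceOfFacts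
  Summit.BirchSwinnertonDyer.Rank1Residual.X2.GreenbergProp510OfFacts
  Summit.BirchSwinnertonDyer.Rank1Residual.X2.ClassClosureOfDerivedF0
  Summit.BirchSwinnertonDyer.Rank1Residual.X2.NonPrimitiveLambdaInvariantMultiplicativeDerived
  Summit.BirchSwinnertonDyer.Rank1Residual.X2.TrivialZeroStrictInclusionDerived

namespace Summit.BirchSwinnertonDyer.Rank1Residual.X2.GreenbergVatsalCaseTwoPeriodFree

/-! ## §1. CASE 2 without `hP` -/

/-- **GV CASE 2 (rational line UNRAMIFIED at `p` and ODD) of the `λ`/`μ^anal` clause at an odd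
multiplicative prime, period input DERIVED**: gen 18's `caseTwo_clause_of_inputs` verbatim, except
that the quotient `E' = E/Φ₀`, the isogeny and the period relation `Ω_{E'} = u·Ω_E`, `|u|_p = 1` now
come from the kernel theorem `IsogenyPeriodRatio.exists_quot_realPeriodRat_eq_unit_mul` instead of
the registered fact A180 (GV Cor. (3.8)). [cite: GreenbergVatsal2000, §2 p. 28, §3 Cor. (3.8)]
[cite: DokchitserLocalInvariants2015, Prop. 18 and Thm. 2] -/
theorem caseTwo_clause_of_inputs_periodFree
    (hT : Silverman1994_thmV53_tateUniformisation.{0})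
    (hT' : Silverman1994_thmV53_corV54_tateUniformisation.{0})
    (hA : lambda_nonPrimitive_eq_add_sum_delta_multiplicative)
    (hB : datumSelmer_divisible_of_finite_torsionBy)
    (hF : datumStrictSelmer_lt_datumSelmer_of_split)
    (hG : Greenberg1999.prop510_isTorsion_hasUnitContent_of_gvPar)
    (hLift : ∀ (W : WeierstrassCurve ℚ) [W.IsGloballyMinimal] [W.IsElliptic] (p : ℕ) [Fact p.Prime]
      (κ : ZpExtension ℚ p) (S₀ : Finset (HeightOneSpectrum (𝓞 ℚ)))
      (Φ₀ : AddSubgroup (W.geomTorsion (p : ℤ))) (hΦ : IsRationalLine W p Φ₀),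
      p ≠ 2 → κ.IsCyclotomic → ¬ LineUnramifiedAt W p Φ₀ → LineEven W p Φ₀ →
      (∀ v ∈ S₀, ((p : ℕ) : 𝓞 ℚ) ∉ v.asIdeal) →
      (∀ v : HeightOneSpectrum (𝓞 ℚ), v ∉ S₀ → ((p : ℕ) : 𝓞 ℚ) ∉ v.asIdeal →
        W.HasGoodReductionAt v) →
      GVLiftingInput W p κ S₀ Φ₀ hΦ)
    (hAn : ∀ (W : WeierstrassCurve ℚ) [W.IsGloballyMinimal] [W.IsElliptic] (p : ℕ) [Fact p.Prime]
      (κ : ZpExtension ℚ p) {N : ℕ} [NeZero N] (f : CuspForm (Gamma0 N) 2)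
      (S₀ : Finset (HeightOneSpectrum (𝓞 ℚ)))
      (Φ₀ : AddSubgroup (W.geomTorsion (p : ℤ))) (hΦ : IsRationalLine W p Φ₀),
      p ≠ 2 → W.HasMultiplicativeReductionAtPrime p → κ.IsCyclotomic →
      ¬ LineUnramifiedAt W p Φ₀ → LineEven W p Φ₀ → IsNewformOf W f →
      (∀ v ∈ S₀, ((p : ℕ) : 𝓞 ℚ) ∉ v.asIdeal) →
      (∀ v : HeightOneSpectrum (𝓞 ℚ), v ∉ S₀ → ((p : ℕ) : 𝓞 ℚ) ∉ v.asIdeal →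
        W.HasGoodReductionAt v) →
      GVAnalyticInput W p κ f S₀ Φ₀ hΦ)
    (W : WeierstrassCurve ℚ) [W.IsElliptic] [W.IsGloballyMinimal] (p : ℕ) [Fact p.Prime]
    {κ : ZpExtension ℚ p} {γ : absoluteGaloisGroup ℚ} {N : ℕ} [NeZero N]
    {f : CuspForm (Gamma0 N) 2}
    (hp : p ≠ 2) (hmult : W.HasMultiplicativeReductionAtPrime p)
    {Φ₀ : AddSubgroup (W.geomTorsion (p : ℤ))} (hΦ : IsRationalLine W p Φ₀)
    (hunr : LineUnramifiedAt W p Φ₀) (hodd : LineOdd W p Φ₀)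
    (hκ : κ.IsCyclotomic) (hγ : κ.IsTopGenerator γ) (hf : IsNewformOf W f)
    (D : W.SelmerDualData κ γ) (ϖ : ℚ) (hϖ : (ϖ : ℝ) * W.realPeriodRat = plusPeriod f)
    (fE : IwasawaAlgebra p) (hchar : D.charIdeal = Ideal.span {fE}) :
    (W.HasSplitMultiplicativeReductionAtPrime p →
        ∀ (L : PowerSeries ℚ_[p]), IsSplitMultPAdicLFunctionOf f p L →
        ∀ (b : IwasawaAlgebra p), iwasawaToPowerSeries p b = PowerSeries.C ((ϖ : ℚ) : ℚ_[p]) * L →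
          HasUnitContent b ∧
            (PowerSeries.map (PadicInt.toZMod (p := p)) b).order =
              (PowerSeries.map (PadicInt.toZMod (p := p)) (PowerSeries.X * fE)).order) ∧
      (¬ W.HasSplitMultiplicativeReductionAtPrime p →
        ∀ (L : PowerSeries ℚ_[p]), IsMultPAdicLFunctionOf f p (-1) L →
        ∀ (b : IwasawaAlgebra p), iwasawaToPowerSeries p b = PowerSeries.C ((ϖ : ℚ) : ℚ_[p]) * L →
          HasUnitContent b ∧
            (PowerSeries.map (PadicInt.toZMod (p := p)) b).order =
              (PowerSeries.map (PadicInt.toZMod (p := p)) fE).order) := by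
  -- the quotient `E' = E/Φ₀` on a globally minimal model, with its ramified-even line
  obtain ⟨W', _, _, g, hker, -, u, hu1, hΩ⟩ :=
    IsogenyPeriodRatio.exists_quot_realPeriodRat_eq_unit_mul hp (Or.inr hmult) hΦ hunr hodd
  obtain ⟨Φ', hΦ', hram', heven'⟩ :=
    exists_rationalLine_ramified_even_of_isogeny hT hT' hp hmult hΦ hunr hodd g hker
  have hiso : IsIsogenous W W' := ⟨g⟩
  have hmult' : W'.HasMultiplicativeReductionAtPrime p :=
    hasMultiplicativeReductionAtPrime_of_isIsogenous hiso hmult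
  have hsplit_iff : W.HasSplitMultiplicativeReductionAtPrime p ↔
      W'.HasSplitMultiplicativeReductionAtPrime p :=
    hasSplitMultiplicativeReductionAtPrime_iff_of_isIsogenous hiso
  have hf' : IsNewformOf W' f := hf.of_isIsogenous hiso.symm_of_charZero
  have hgv : GVPar W p := ⟨Φ₀, hΦ, Or.inr ⟨hunr, hodd⟩⟩
  have hgv' : GVPar W' p := ⟨Φ', hΦ', Or.inl ⟨hram', heven'⟩⟩
  -- the period: `Ω_{E'} = u · Ω_E`, `|u|_p = 1` (Cor. (3.8), DERIVED: `X2/IsogenyPeriodRatio`)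
  have hu0 : (u : ℚ_[p]) ≠ 0 := fun h ↦ by simp [h] at hu1
  have hu0' : u ≠ 0 := fun h ↦ hu0 (by rw [h, Rat.cast_zero])
  set cU : ℤ_[p]ˣ := PadicInt.mkUnits hu1 with hcU
  have hcUinv : (((cU⁻¹ : ℤ_[p]ˣ) : ℤ_[p]) : ℚ_[p]) = (u : ℚ_[p])⁻¹ := by
    apply eq_inv_of_mul_eq_one_left
    rw [← PadicInt.mkUnits_eq hu1, ← PadicInt.coe_mul, Units.inv_mul, PadicInt.coe_one]
  have hϖ' : ((ϖ / u : ℚ) : ℝ) * W'.realPeriodRat = plusPeriod f := by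
    rw [hΩ, Rat.cast_div, ← hϖ, ← mul_assoc,
      div_mul_cancel₀ _ (by exact_mod_cast hu0' : (u : ℝ) ≠ 0)]
  -- a dual datum for `E'`; `μ = 0` on both sides (Prop. 5.10); `λ(E) = λ(E')` (isogeny invariance)
  obtain ⟨D'⟩ := W'.nonempty_selmerDualData_holds κ γ hγ
  haveI := WeierstrassCurve.SelmerDualData.module_finite_of_isCyclotomic W κ hκ D hγ
  haveI := WeierstrassCurve.SelmerDualData.module_finite_of_isCyclotomic W' κ hκ D' hγ
  obtain ⟨hX, fE₀, hchar₀, huf₀⟩ := hG.of_mult W p hp hmult hgv hκ hγ D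
  obtain ⟨hX', fE', hchar', huf'⟩ := hG.of_mult W' p hp hmult' hgv' hκ hγ D'
  have hμ : D.mu = 0 := (mu_eq_zero_iff_hasUnitContent D hX hchar₀).mpr huf₀
  have hμ' : D'.mu = 0 := (mu_eq_zero_iff_hasUnitContent D' hX' hchar').mpr huf'
  have hord : (PowerSeries.map (PadicInt.toZMod (p := p)) fE).order =
      (PowerSeries.map (PadicInt.toZMod (p := p)) fE').order := by
    rw [← natCast_lambdaInvariant_eq_order_map_toZMod D hX hμ hchar,
      ← natCast_lambdaInvariant_eq_order_map_toZMod D' hX' hμ' hchar',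
      lambdaInvariant_eq_of_isogeny g D D']
  -- CASE 1 for `E'`
  have hcl' := caseOne_clause_of_inputs hT hT' hA hB hF hG hLift hAn W' p hp hmult' hΦ' hram' heven'
    hκ hγ hf' D' (ϖ / u) hϖ' fE' hchar'
  -- transport of `b`: `b' = C(c⁻¹)·b` has `ι b' = (ϖ/u)·L`, and `b = C(c)·b'`
  have key : ∀ (L : PowerSeries ℚ_[p]) (b : IwasawaAlgebra p),
      iwasawaToPowerSeries p b = PowerSeries.C ((ϖ : ℚ) : ℚ_[p]) * L →
      iwasawaToPowerSeries p (PowerSeries.C ((cU⁻¹ : ℤ_[p]ˣ) : ℤ_[p]) * b) =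
          PowerSeries.C (((ϖ / u : ℚ)) : ℚ_[p]) * L ∧
        b = PowerSeries.C ((cU : ℤ_[p]ˣ) : ℤ_[p]) * (PowerSeries.C ((cU⁻¹ : ℤ_[p]ˣ) : ℤ_[p]) * b) := by
    intro L b hιb
    refine ⟨?_, ?_⟩
    · rw [iwasawaToPowerSeries_C_mul, hιb, ← mul_assoc, ← map_mul, Rat.cast_div, div_eq_inv_mul,
        hcUinv]
    · rw [← mul_assoc, ← map_mul, Units.mul_inv, map_one, one_mul]
  refine ⟨fun hsplit L hL b hιb ↦ ?_, fun hns L hL b hιb ↦ ?_⟩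
  · obtain ⟨hιb', hb⟩ := key L b hιb
    obtain ⟨hub', hord'⟩ := hcl'.1 (hsplit_iff.mp hsplit) L hL _ hιb'
    obtain ⟨hC1, hC2⟩ := hasUnitContent_and_order_C_mul cU
      (PowerSeries.C ((cU⁻¹ : ℤ_[p]ˣ) : ℤ_[p]) * b)
    refine ⟨?_, ?_⟩
    · rw [hb]; exact hC1.mpr hub'
    · rw [hb, hC2, hord', map_mul, map_mul, PowerSeries.order_mul, PowerSeries.order_mul, hord]
  · obtain ⟨hιb', hb⟩ := key L b hιb
    obtain ⟨hub', hord'⟩ := hcl'.2 (fun h ↦ hns (hsplit_iff.mpr h)) L hL _ hιb'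
    obtain ⟨hC1, hC2⟩ := hasUnitContent_and_order_C_mul cU
      (PowerSeries.C ((cU⁻¹ : ℤ_[p]ˣ) : ℤ_[p]) * b)
    refine ⟨?_, ?_⟩
    · rw [hb]; exact hC1.mpr hub'
    · rw [hb, hC2, hord', hord]


/-! ## §2. A64 / A63 without `hP` -/

/-- **A64 = `GreenbergVatsal2000.lambda_muAnal_multiplicative_of_gvPar` from the CASE-1 inputs,
period-free**: gen 18's `lambda_muAnal_multiplicative_of_gvPar_of_inputs` with CASE 2 replaced by
`caseTwo_clause_of_inputs_periodFree`. [cite: GreenbergVatsal2000, Thm. (1.3), §2 (16) and p. 28, §3 Thm. (3.11)] -/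
theorem lambda_muAnal_multiplicative_of_gvPar_of_inputs_periodFree
    (hT : Silverman1994_thmV53_tateUniformisation.{0})
    (hT' : Silverman1994_thmV53_corV54_tateUniformisation.{0})
    (hA : lambda_nonPrimitive_eq_add_sum_delta_multiplicative)
    (hB : datumSelmer_divisible_of_finite_torsionBy)
    (hF : datumStrictSelmer_lt_datumSelmer_of_split)
    (hG : Greenberg1999.prop510_isTorsion_hasUnitContent_of_gvPar)
    (hLift : ∀ (W : WeierstrassCurve ℚ) [W.IsGloballyMinimal] [W.IsElliptic] (p : ℕ) [Fact p.Prime]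
      (κ : ZpExtension ℚ p) (S₀ : Finset (HeightOneSpectrum (𝓞 ℚ)))
      (Φ₀ : AddSubgroup (W.geomTorsion (p : ℤ))) (hΦ : IsRationalLine W p Φ₀),
      p ≠ 2 → κ.IsCyclotomic → ¬ LineUnramifiedAt W p Φ₀ → LineEven W p Φ₀ →
      (∀ v ∈ S₀, ((p : ℕ) : 𝓞 ℚ) ∉ v.asIdeal) →
      (∀ v : HeightOneSpectrum (𝓞 ℚ), v ∉ S₀ → ((p : ℕ) : 𝓞 ℚ) ∉ v.asIdeal →
        W.HasGoodReductionAt v) →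
      GVLiftingInput W p κ S₀ Φ₀ hΦ)
    (hAn : ∀ (W : WeierstrassCurve ℚ) [W.IsGloballyMinimal] [W.IsElliptic] (p : ℕ) [Fact p.Prime]
      (κ : ZpExtension ℚ p) {N : ℕ} [NeZero N] (f : CuspForm (Gamma0 N) 2)
      (S₀ : Finset (HeightOneSpectrum (𝓞 ℚ)))
      (Φ₀ : AddSubgroup (W.geomTorsion (p : ℤ))) (hΦ : IsRationalLine W p Φ₀),
      p ≠ 2 → W.HasMultiplicativeReductionAtPrime p → κ.IsCyclotomic →
      ¬ LineUnramifiedAt W p Φ₀ → LineEven W p Φ₀ → IsNewformOf W f →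
      (∀ v ∈ S₀, ((p : ℕ) : 𝓞 ℚ) ∉ v.asIdeal) →
      (∀ v : HeightOneSpectrum (𝓞 ℚ), v ∉ S₀ → ((p : ℕ) : 𝓞 ℚ) ∉ v.asIdeal →
        W.HasGoodReductionAt v) →
      GVAnalyticInput W p κ f S₀ Φ₀ hΦ) :
    lambda_muAnal_multiplicative_of_gvPar := by
  intro W _ _ p _ κ γ N _ f hp hmult hpar hκ hγ _hγ' hf D ϖ hϖ fE hchar
  obtain ⟨Φ₀, hΦ, hcase⟩ := hpar
  rcases hcase with ⟨hram, heven⟩ | ⟨hunr, hodd⟩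
  · exact caseOne_clause_of_inputs hT hT' hA hB hF hG hLift hAn W p hp hmult hΦ hram heven hκ hγ hf D
      ϖ hϖ fE hchar
  · exact caseTwo_clause_of_inputs_periodFree hT hT' hA hB hF hG hLift hAn W p hp hmult hΦ hunr hodd
      hκ hγ hf D ϖ hϖ fE hchar

/-- **A64 from NINE registered facts, period-free** {T-GV23L `h23`, A137′ `hInf`, A40 `hT`, A41 `hT'`,
A135 `hB`, A195 `hLiftF`, A226 `h311`, A224 `hC`, A225 `hD`}: gen 27's
`lambda_muAnal_multiplicative_of_gvPar_of_derivedTrivialZero` (ten facts) with A180 discharged —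
the same suppliers (`lambda_nonPrimitive_eq_add_sum_delta_multiplicative_of_datum`,
`datumStrictSelmer_lt_datumSelmer_of_split_of_relIndex`, `prop510_isTorsion_hasUnitContent_of_gvPar_of_facts`,
`gvLiftingInput_of_fact`, `gvAnalyticInput_of_fact ∘ nonPrimitive_unitContent_and_lambda_eq_residual_of_lineRamifiedEven_of_facts`,
`exists_characterLFunction_holds`) fed into the period-free `…_of_inputs`. Bookkeeping.
[cite: GreenbergVatsal2000, Thm. (1.3), §1 pp. 14–15, §2 (16), Prop. (2.1), pp. 28–30, §3 Thm. (3.11), (28), pp. 41–43] -/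
theorem lambda_muAnal_multiplicative_of_gvPar_periodFree
    (h23 : datumSelmer_nonPrimitive_invariants)
    (hInf : datumStrictSelmer_relIndex_eq_zero_of_split)
    (hT : Silverman1994_thmV53_tateUniformisation.{0})
    (hT' : Silverman1994_thmV53_corV54_tateUniformisation.{0})
    (hB : datumSelmer_divisible_of_finite_torsionBy)
    (hLiftF : residualEpsilon_surjOn_of_lineRamifiedEven)
    (h311 : thm311_hasUnitContent_iff_and_order_eq_of_lineRamifiedEven)
    (hC : characterLFunctionC_hasUnitContent_and_order_eq_card)
    (hD : characterLFunctionD_hasUnitContent_and_order_eq_card) :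
    lambda_muAnal_multiplicative_of_gvPar :=
  lambda_muAnal_multiplicative_of_gvPar_of_inputs_periodFree hT hT'
    (lambda_nonPrimitive_eq_add_sum_delta_multiplicative_of_datum h23 hT hT' hInf) hB
    (datumStrictSelmer_lt_datumSelmer_of_split_of_relIndex hT hInf)
    (prop510_isTorsion_hasUnitContent_of_gvPar_of_facts hT hT' exists_characterLFunction_holds hC hD)
    (fun W _ _ p _ κ S₀ Φ₀ hΦ hp hκ hram heven hS₀ hS ↦
      gvLiftingInput_of_fact hLiftF W p κ S₀ Φ₀ hΦ hp hκ hram heven hS₀ hS)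
    (fun W _ _ p _ κ _ _ f S₀ Φ₀ hΦ hp hmult hκ hram heven hf hS₀ hS ↦
      gvAnalyticInput_of_fact
        (nonPrimitive_unitContent_and_lambda_eq_residual_of_lineRamifiedEven_of_facts hT hT'
          exists_characterLFunction_holds h311 hC hD)
        W p κ f S₀ Φ₀ hΦ hp hmult hκ hram heven hf hS₀ hS)

/-- **A63 = `GreenbergVatsal2000.lambdaMu_multiplicative_of_gvPar` from TEN registered facts,
period-free** (those of `lambda_muAnal_multiplicative_of_gvPar_periodFree` + Wuthrich 2014 Thm. 16,
`hWu` A33), by the tree's `lambdaMu_multiplicative_of_gvPar_of_parts`. Bookkeeping.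
[cite: GreenbergVatsal2000, Thm. (1.3), §1 pp. 14–15, §2 (16), pp. 28–30, §3 Thm. (3.11), (28), pp. 41–43]
[cite: Wuthrich2014, Thm. 16 (p. 397)] -/
theorem lambdaMu_multiplicative_of_gvPar_periodFree
    (h23 : datumSelmer_nonPrimitive_invariants)
    (hInf : datumStrictSelmer_relIndex_eq_zero_of_split)
    (hT : Silverman1994_thmV53_tateUniformisation.{0})
    (hT' : Silverman1994_thmV53_corV54_tateUniformisation.{0})
    (hB : datumSelmer_divisible_of_finite_torsionBy)
    (hLiftF : residualEpsilon_surjOn_of_lineRamifiedEven)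
    (h311 : thm311_hasUnitContent_iff_and_order_eq_of_lineRamifiedEven)
    (hC : characterLFunctionC_hasUnitContent_and_order_eq_card)
    (hD : characterLFunctionD_hasUnitContent_and_order_eq_card)
    (hWu : thm16_charIdeal_dvd_multiplicative_of_reducible) :
    lambdaMu_multiplicative_of_gvPar :=
  lambdaMu_multiplicative_of_gvPar_of_parts hWu
    (prop510_isTorsion_hasUnitContent_of_gvPar_of_facts hT hT' exists_characterLFunction_holds hC hD)
    (lambda_muAnal_multiplicative_of_gvPar_periodFree h23 hInf hT hT' hB hLiftF h311 hC hD)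

/-! ## §3. The X2a closure terms without `hP` -/

/-- **Mazur's main conjecture at every odd multiplicative pair of GV parity from TEN registered
facts** (gen 27: eleven; A180 discharged). Bookkeeping over `X2.mazurMainConjectureAt_of_gvPar`.
[cite: GreenbergVatsal2000, Thm. (1.3) with §1 pp. 14–15, §2 pp. 28–30, §3 Thm. (3.11)]
[cite: Wuthrich2014, Thm. 16 (p. 397)] -/
theorem mazurMainConjectureAt_of_gvPar_periodFree
    (h23 : datumSelmer_nonPrimitive_invariants)
    (hInf : datumStrictSelmer_relIndex_eq_zero_of_split)
    (hT : Silverman1994_thmV53_tateUniformisation.{0})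
    (hT' : Silverman1994_thmV53_corV54_tateUniformisation.{0})
    (hB : datumSelmer_divisible_of_finite_torsionBy)
    (hLiftF : residualEpsilon_surjOn_of_lineRamifiedEven)
    (h311 : thm311_hasUnitContent_iff_and_order_eq_of_lineRamifiedEven)
    (hC : characterLFunctionC_hasUnitContent_and_order_eq_card)
    (hD : characterLFunctionD_hasUnitContent_and_order_eq_card)
    (hWu : thm16_charIdeal_dvd_multiplicative_of_reducible)
    (W : WeierstrassCurve ℚ) [W.IsElliptic] [W.IsGloballyMinimal] (p : ℕ) [Fact p.Prime]
    (hp : p ≠ 2) (hmult : W.HasMultiplicativeReductionAtPrime p) (hgv : GVPar W p) :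
    MazurMainConjectureAt W p :=
  X2.mazurMainConjectureAt_of_gvPar
    (lambdaMu_multiplicative_of_gvPar_periodFree h23 hInf hT hT' hB hLiftF h311 hC hD hWu) hWu W p hp
    hmult hgv

/-- **`X2.TargetA` (the X2a closure of record: `BSD(E,p)` at every pair with `r_an = 0`, `p` odd
multiplicative, GV parity) from SIXTEEN registered facts** — gen 27's
`targetA_of_derivedTrivialZero_heightFree` (seventeen) with the period fact A180 (`hP`) DISCHARGED by
gen 28's kernel theorem. Registered inputs: T-GV23L `h23` · A137′ `hInf` · A40/A41 `hT`/`hT'` ·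
A135 `hB` · A195 `hLiftF` · A226 `h311` · A224/A225 `hC`/`hD` · A33 `hWu` · Stein–Wuthrich Thm. 6.1
`hJs`/`hJn` · `hGZK` · `hmod` · `hpar` · `hGS`.
[cite: GreenbergVatsal2000, Thm. (1.3) with pp. 1, 14–15, §2 pp. 28–30, §3 Thm. (3.11), pp. 41–43]
[cite: Wuthrich2014, Thm. 16 (p. 397)] [cite: SteinWuthrich2013, Thm. 6.1 (p. 20), §4.2] -/
theorem targetA_periodFree_heightFree
    (h23 : datumSelmer_nonPrimitive_invariants)
    (hInf : datumStrictSelmer_relIndex_eq_zero_of_split)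
    (hT : Silverman1994_thmV53_tateUniformisation.{0})
    (hT' : Silverman1994_thmV53_corV54_tateUniformisation.{0})
    (hB : datumSelmer_divisible_of_finite_torsionBy)
    (hLiftF : residualEpsilon_surjOn_of_lineRamifiedEven)
    (h311 : thm311_hasUnitContent_iff_and_order_eq_of_lineRamifiedEven)
    (hC : characterLFunctionC_hasUnitContent_and_order_eq_card)
    (hD : characterLFunctionD_hasUnitContent_and_order_eq_card)
    (hWu : thm16_charIdeal_dvd_multiplicative_of_reducible)
    (hJs : thm61_splitMultiplicative) (hJn : thm61_nonsplitMultiplicative)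
    (hGZK : rank_eq_analyticRank_of_analyticRank_le_one) (hmod : hasEntireLFunction_rat)
    (hpar : nonempty_modularParametrizationData)
    (hGS : ∀ (W : WeierstrassCurve ℚ) [W.IsElliptic] [W.IsGloballyMinimal] (p : ℕ) [Fact p.Prime],
      greenberg_stevens (W := W) (p := p)) :
    TargetA :=
  X2.targetA_of_published_heightFree
    (lambdaMu_multiplicative_of_gvPar_periodFree h23 hInf hT hT' hB hLiftF h311 hC hD hWu)
    hWu hJs hJn hGZK hmod hpar hGS

end Summit.BirchSwinnertonDyer.Rank1Residual.X2.GreenbergVatsalCaseTwoPeriodFree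

end
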